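import Summits.NavierStokesRegularity.NavierStokesRegularity.Theorems.EulerZoomLiouvillePowerGaugeEulerLiouvilleBreatherLocData
import Summits.NavierStokesRegularity.NavierStokesRegularity.Theorems.EulerZoomLiouvillePowerGaugeEulerLiouvilleClassicalProfileLEE
import Summits.NavierStokesRegularity.NavierStokesRegularity.Theorems.EulerZoomLiouvillePowerGaugeEulerLiouvilleEnergySaturationLoc

/-!
# Crux `EulerZoomLiouville.PowerGaugeEulerLiouville` (stmt-NavierStokesRegularity-19832), line `logtime-breathers` (T2/T3):
# BREATHER RIGIDITY — every classical log-time breather in the class is trivial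

Width seat `ns-ezl-w4` (breather rigidity, file VII, the member; sequel of `…BreatherLocData`, `…ClassicalProfileLEE`).

`BreatherRigidity.ae_eq_zero_of_gauge_of_classicalBreather`: crux hypotheses (weak gradient `H`, the three power gauges,
`0 < ρ ≤ ½`) + `(u, p)` classical Euler on `(−∞,0) × ℝ³` + `u(τ, y) = e^{cτ} V(e^{−cτ} y)` for all `τ < 0` with `c ≠ 0`
⇒ `u = 0` a.e. on `(−∞,0) × ℝ³`.  NO tameness, NO finite energy, NO hypothesis on the pressure: the line's stub T2b
(`LogtimeBreather.ae_eq_zero_of_gauge_of_tameBreather`) without `htame`, and the classical part of the residue T3.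

Proof (the power clock's energy-saturation argument has no analogue — the breather's profile equation
`cV − c(z·∇)V + (V·∇)V + ∇P = 0` is no power-clock profile equation —, but its SCALE ODE is better): with the radial cut-off
`σ` and `I(L) = ∫σ(L⁻¹y)|V|²`, the classical local energy equality gives `5c I = F_σ + c X_σ`, i.e.
`(L^{−5} I(L))' = −c⁻¹ L^{−6} F_σ(L)` (`ClassicalProfile.rpow_mul_cutoffEnergy_sub_eq`, `κ = −5`, `β = −c`); the `A`-gauge
kills the boundary term at `L = ∞`, so `L^{−5} I(L) = c⁻¹∫_L^∞ r^{−6} F_σ`.  The flux bound of the energy-saturation chain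
(`EnergySaturation.exists_fluxWeight_le_of_sup_loc`, fed with the breather's large-scale data `…BreatherLocData.exists_locData`)
`|F_σ(r)| ≲ S^{1/2} r^{1−2ρ−a}` (`a = (2+ρ)/4`, `S` an admissible tail supremum of `N(R) = R^{2ρ−1} I(R)`) then gives
`N(R) ≤ B₀ S^{1/2} L^{−a}` on `[L, ∞)`; absorption `S ≤ B₀ S^{1/2} L^{−a} ⇒ S ≤ B₀² L^{−2a}` and `1 − 2ρ − 2a = −5ρ/2 < 0`
force `∫_{B_L}|V|² → 0`, so `V = 0`.

WHAT THIS IS NOT: not NS regularity, not the crux — a sub-stratum of the crux CLASS 19832 on the MODEL lattice (all classical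
log-time breathers); the non-classical breathers of T3 stay open; `--supports` stmt-19832. [folklore]
-/

noncomputable section

set_option linter.dupNamespace false

open MeasureTheory Set Filter Topology Metric Function TopologicalSpace
open scoped ENNReal NNReal RealInnerProductSpace ContDiff Laplacian

namespace Summit.NavierStokesRegularity.NavierStokesRegularity.Theorems.PowerGaugeEulerLiouville

open Literature.Analysis Literature.Analysis.FunctionSpaces Literature.Analysis.FluidPDE

namespace BreatherRigidity

variable {u : ℝ → EuclideanSpace ℝ (Fin 3) → EuclideanSpace ℝ (Fin 3)} {p : ℝ → EuclideanSpace ℝ (Fin 3) → ℝ}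
  {H : ℝ → EuclideanSpace ℝ (Fin 3) → EuclideanSpace ℝ (Fin 3) →L[ℝ] EuclideanSpace ℝ (Fin 3)}

/-- **BREATHER RIGIDITY: CLASSICAL LOG-TIME BREATHERS IN THE CLASS ARE TRIVIAL.**  Crux hypotheses (weak spatial gradient `H`
on the slab, the three power gauges, `0 < ρ ≤ ½`) + `(u, p)` classical Euler on `(−∞, 0) × ℝ³` + `u(τ, y) = e^{cτ} V(e^{−cτ} y)`
for all `τ < 0` with `c ≠ 0` ⇒ `u = 0` a.e. on `(−∞,0) × ℝ³` — no tameness, no finite energy, no pressure hypothesis.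
(The suitable-weak component of the class is idle and not taken.) [folklore] -/
theorem ae_eq_zero_of_gauge_of_classicalBreather {ρ : ℝ} (hρ : 0 < ρ) (hρh : ρ ≤ 1 / 2) {c₀ : ℝ≥0}
    (hH : HasWeakSpatialGradientOn (slab (EuclideanSpace ℝ (Fin 3)) (Iio 0) isOpen_Iio) u H)
    (hgauge : ∀ a : ℝ, 0 < a →
      ENNReal.ofReal (a ^ (2 * ρ)) * cknA a (0 : ℝ × EuclideanSpace ℝ (Fin 3)) u +
          ENNReal.ofReal (a ^ ρ) * cknE a (0 : ℝ × EuclideanSpace ℝ (Fin 3)) H +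
        ENNReal.ofReal (a ^ (2 * ρ)) * cknD a (0 : ℝ × EuclideanSpace ℝ (Fin 3)) p ≤ (c₀ : ℝ≥0∞))
    (hcl : IsClassicalEulerSolutionOn (Iio 0) 0 u p) {c : ℝ} {V : EuclideanSpace ℝ (Fin 3) → EuclideanSpace ℝ (Fin 3)}
    (hc : c ≠ 0) (hbr : ∀ τ : ℝ, τ < 0 → ∀ y, u τ y = Real.exp (c * τ) • V (Real.exp (-(c * τ)) • y)) :
    uncurry u =ᵐ[volume.restrict (Iio (0 : ℝ) ×ˢ (univ : Set (EuclideanSpace ℝ (Fin 3))))] 0 := by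
  have hρ1 : ρ < 1 := by linarith
  have h2ρ : (0 : ℝ) < 2 + ρ := by linarith
  obtain ⟨P, c', hP1, heq, hA, hE, hD⟩ := exists_locData hρ hρh hH hgauge hcl hbr
  have hc0 : (0 : ℝ) ≤ c' := c'.2
  -- ### the profile data
  have hV1 : ContDiff ℝ 1 V := (contDiff_profile hcl hbr).of_le (by exact_mod_cast le_top)
  have hVc : Continuous V := hV1.continuous
  have hdiv := isDivFree_profile hcl hbr
  have hVm : AEStronglyMeasurable V volume := hVc.aestronglyMeasurable
  have hPm : AEStronglyMeasurable P volume := hP1.continuous.aestronglyMeasurable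
  have hGm : AEStronglyMeasurable (fderiv ℝ V) volume := (hV1.continuous_fderiv one_ne_zero).aestronglyMeasurable
  have hVG : HasWeakFDerivOn (⊤ : Opens (EuclideanSpace ℝ (Fin 3))) volume V (fderiv ℝ V) :=
    hasWeakGradient_fderiv_of_contDiff hV1
  have hPoisson : ∀ θ : EuclideanSpace ℝ (Fin 3) → ℝ, ContDiff ℝ (⊤ : ℕ∞) θ → HasCompactSupport θ →
      ∫ y, P y * (Δ θ) y = -∫ y, fderiv ℝ (fderiv ℝ θ) y (V y) (V y) :=
    fun θ hθ hθc => ClassicalProfile.pressure_poisson hV1 hP1 hdiv heq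
      (hθ.of_le (by norm_cast)) hθc
  have hV2 : LocallyIntegrable (fun y => ‖V y‖ ^ 2) volume :=
    EnergySaturation.locallyIntegrable_norm_sq_of_growth_loc hVm hA
  -- ### the radial cut-off and the breather local energy equality at every scale
  obtain ⟨σ, hσs, hσc, h0, h1, hone, hzero, -⟩ := exists_radialCutoff
  have hσ : IsTestFunctionOn (⊤ : Opens (EuclideanSpace ℝ (Fin 3))) σ := ⟨hσs, hσc, fun _ _ => trivial⟩
  have hσ1 : ContDiff ℝ 1 σ := hσs.of_le (by exact_mod_cast le_top)
  have hEEσ : ∀ L : ℝ, 0 < L → (-5 : ℝ) * (-c) * ∫ x, σ (L⁻¹ • x) * ‖V x‖ ^ 2 =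
      (∫ x, (‖V x‖ ^ 2 + 2 * P x) * ⟪V x, gradient (fun z => σ (L⁻¹ • z)) x⟫) +
        (-c) * ∫ x, ‖V x‖ ^ 2 * ⟪x, gradient (fun z => σ (L⁻¹ • z)) x⟫ := by
    intro L hL
    have h := ClassicalProfile.local_energy_equality hV1 hP1 hdiv heq (hσ1.comp (contDiff_const_smul L⁻¹))
      (hσc.comp_smul (inv_ne_zero hL.ne'))
    have h5 : (2 * c - 3 * (-c)) = (-5 : ℝ) * (-c) := by ring
    rw [h5] at h
    exact h
  have hβ : (-c) ≠ 0 := neg_ne_zero.2 hc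
  -- ### the normalised energy `N`
  set N : ℝ → ℝ := fun R => R ^ (2 * ρ - 1) * ∫ y, σ (R⁻¹ • y) * ‖V y‖ ^ 2 with hN
  have hI0 : ∀ R : ℝ, 0 ≤ ∫ y, σ (R⁻¹ • y) * ‖V y‖ ^ 2 := fun R =>
    integral_nonneg fun y => mul_nonneg (h0 _) (sq_nonneg _)
  have hN0 : ∀ R, 0 < R → 0 ≤ N R := fun R hR => mul_nonneg (Real.rpow_nonneg hR.le _) (hI0 R)
  have hN3 : ∀ R, 1 ≤ R → N R ≤ 3 * c' := by
    intro R hR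
    have h := EnergySaturation.normEnergy_le_of_growth_loc (ρ := ρ) h0 h1 hzero hVm hA hR
    have h3 : (3 : ℝ) ^ (1 - 2 * ρ) ≤ 3 := by
      conv_rhs => rw [← Real.rpow_one 3]
      exact Real.rpow_le_rpow_of_exponent_le (by norm_num) (by linarith)
    exact h.trans (by gcongr)
  -- ### the flux bound of the energy-saturation chain
  obtain ⟨A, hA0, hflux⟩ := EnergySaturation.exists_fluxWeight_le_of_sup_loc hρ hρ1 hσ h0 h1 hone hzero hVm hPm hGm hVG
    hA hE hD hPoisson
  set a : ℝ := (2 + ρ) / 4 with hadef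
  have ha0 : 0 < a := by rw [hadef]; positivity
  have hcabs : 0 < |c| := abs_pos.2 hc
  set e : ℝ := -5 - a - 2 * ρ with hedef
  have he1 : e + 1 < 0 := by rw [hedef]; linarith
  set K : ℝ := A / ((2 + ρ) * |c|) with hK
  have hK0 : 0 ≤ K := by rw [hK]; positivity
  set B₀ : ℝ := K / (-(e + 1)) with hB₀
  have hB₀0 : 0 ≤ B₀ := div_nonneg hK0 (by linarith)
  -- ### KEY (the scale ODE): an admissible `S` on `[L, ∞)` gives `N(R) ≤ B₀ S^{1/2} L^{-a}` on `[L, ∞)`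
  have hkey : ∀ L : ℝ, 1 ≤ L → ∀ S : ℝ, 0 ≤ S → S ≤ 3 * c' → (∀ R, L ≤ R → N R ≤ S) →
      ∀ R, L ≤ R → N R ≤ B₀ * S ^ (1 / 2 : ℝ) * L ^ (-a) := by
    intro L hL S hS hS3 hSsup R hR
    have hL0 : 0 < L := lt_of_lt_of_le one_pos hL
    have hR0 : 0 < R := lt_of_lt_of_le hL0 hR
    have hR1 : 1 ≤ R := hL.trans hR
    have hS12 : 0 ≤ S ^ (1 / 2 : ℝ) := Real.rpow_nonneg hS _
    have hsup' : ∀ R' : ℝ, L ≤ R' → ∫ y, σ (R'⁻¹ • y) * ‖V y‖ ^ 2 ≤ R' ^ (1 - 2 * ρ) * S := by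
      intro R' hR'
      have hR'0 : 0 < R' := lt_of_lt_of_le hL0 hR'
      have h := hSsup R' hR'
      have hRR : R' ^ (1 - 2 * ρ) * R' ^ (2 * ρ - 1) = 1 := by rw [← Real.rpow_add hR'0]; norm_num
      calc ∫ y, σ (R'⁻¹ • y) * ‖V y‖ ^ 2 = R' ^ (1 - 2 * ρ) * N R' := by
            simp only [hN]; rw [← mul_assoc, hRR, one_mul]
        _ ≤ R' ^ (1 - 2 * ρ) * S := mul_le_mul_of_nonneg_left h (Real.rpow_nonneg hR'0.le _)
    have hfl := hflux S hS hS3 L hL hsup'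
    -- the integrand of the scale ODE is `≤ K S^{1/2} r^e` on `[R, ∞)`
    have hbound : ∀ r : ℝ, R ≤ r → ‖(-c)⁻¹ * r ^ ((-5 : ℝ) - 1) *
        ∫ x, (‖V x‖ ^ 2 + 2 * P x) * ⟪V x, gradient (fun z => σ (r⁻¹ • z)) x⟫‖ ≤ K * S ^ (1 / 2 : ℝ) * r ^ e := by
      intro r hr
      have hr0 : 0 < r := lt_of_lt_of_le hR0 hr
      set F : ℝ := ∫ x, (‖V x‖ ^ 2 + 2 * P x) * ⟪V x, gradient (fun z => σ (r⁻¹ • z)) x⟫ with hF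
      have hfr := hfl r (hR.trans hr)
      have hpos : 0 < (2 + ρ) * r ^ (2 * ρ - 2) := by positivity
      have hFle : |F| ≤ A * S ^ (1 / 2 : ℝ) * r ^ (-1 - (2 + ρ) / 4) / ((2 + ρ) * r ^ (2 * ρ - 2)) := by
        rw [le_div_iff₀ hpos]
        have : |(2 + ρ) * r ^ (2 * ρ - 2) * F| = |F| * ((2 + ρ) * r ^ (2 * ρ - 2)) := by
          rw [abs_mul, abs_of_pos hpos, mul_comm]
        rw [← this]
        exact hfr
      have hexp : r ^ ((-5 : ℝ) - 1) * r ^ (-1 - (2 + ρ) / 4) / r ^ (2 * ρ - 2) = r ^ e := by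
        rw [← Real.rpow_add hr0, ← Real.rpow_sub hr0, hedef, hadef]
        congr 1; ring
      rw [Real.norm_eq_abs, abs_mul, abs_mul, abs_inv, abs_neg, abs_of_pos (Real.rpow_pos_of_pos hr0 _)]
      calc |c|⁻¹ * r ^ ((-5 : ℝ) - 1) * |F|
          ≤ |c|⁻¹ * r ^ ((-5 : ℝ) - 1) * (A * S ^ (1 / 2 : ℝ) * r ^ (-1 - (2 + ρ) / 4) / ((2 + ρ) * r ^ (2 * ρ - 2))) :=
            mul_le_mul_of_nonneg_left hFle (by positivity)
        _ = K * S ^ (1 / 2 : ℝ) * (r ^ ((-5 : ℝ) - 1) * r ^ (-1 - (2 + ρ) / 4) / r ^ (2 * ρ - 2)) := by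
            rw [hK]
            field_simp
        _ = K * S ^ (1 / 2 : ℝ) * r ^ e := by rw [hexp]
    -- the integrated scale ODE on `[R, R']` and the integral bound
    have hId : ∀ R' : ℝ, R ≤ R' →
        R' ^ (-5 : ℝ) * (∫ y, σ (R'⁻¹ • y) * ‖V y‖ ^ 2) - R ^ (-5 : ℝ) * (∫ y, σ (R⁻¹ • y) * ‖V y‖ ^ 2) =
          ∫ r in R..R', (-c)⁻¹ * r ^ ((-5 : ℝ) - 1) *
            ∫ x, (‖V x‖ ^ 2 + 2 * P x) * ⟪V x, gradient (fun z => σ (r⁻¹ • z)) x⟫ :=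
      fun R' hRR' => ClassicalProfile.rpow_mul_cutoffEnergy_sub_eq hβ hσ hVm hV2 hEEσ hR0 hRR'
    have hIb : ∀ R' : ℝ, R ≤ R' →
        |∫ r in R..R', (-c)⁻¹ * r ^ ((-5 : ℝ) - 1) *
            ∫ x, (‖V x‖ ^ 2 + 2 * P x) * ⟪V x, gradient (fun z => σ (r⁻¹ • z)) x⟫| ≤
          B₀ * S ^ (1 / 2 : ℝ) * R ^ (e + 1) := by
      intro R' hRR'
      have hR'0 : 0 < R' := lt_of_lt_of_le hR0 hRR'
      have h0notin : (0 : ℝ) ∉ uIcc R R' := by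
        rw [uIcc_of_le hRR']; exact fun h => (lt_irrefl _) (lt_of_lt_of_le hR0 h.1)
      have hgi : IntervalIntegrable (fun r : ℝ => K * S ^ (1 / 2 : ℝ) * r ^ e) volume R R' :=
        (intervalIntegral.intervalIntegrable_rpow (Or.inr h0notin)).const_mul _
      have hle := intervalIntegral.norm_integral_le_of_norm_le hRR'
        (f := fun r : ℝ => (-c)⁻¹ * r ^ ((-5 : ℝ) - 1) *
          ∫ x, (‖V x‖ ^ 2 + 2 * P x) * ⟪V x, gradient (fun z => σ (r⁻¹ • z)) x⟫)
        (Eventually.of_forall fun r hr => hbound r hr.1.le) hgi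
      rw [intervalIntegral.integral_const_mul, integral_rpow (Or.inr ⟨ne_of_lt (by linarith), h0notin⟩),
        Real.norm_eq_abs] at hle
      refine hle.trans ?_
      have hR'e : 0 ≤ R' ^ (e + 1) := Real.rpow_nonneg hR'0.le _
      have hne : e + 1 ≠ 0 := he1.ne
      have hneg : -(e + 1) ≠ 0 := by intro h; apply hne; linarith
      have hq : K * S ^ (1 / 2 : ℝ) * ((R' ^ (e + 1) - R ^ (e + 1)) / (e + 1)) =
          B₀ * S ^ (1 / 2 : ℝ) * (R ^ (e + 1) - R' ^ (e + 1)) := by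
        rw [hB₀]
        field_simp
        ring
      rw [hq]
      nlinarith [mul_nonneg (mul_nonneg hB₀0 hS12) hR'e]
    -- the boundary term at `∞` vanishes: `R^{-5} I(R) ≤ B₀ S^{1/2} R^{e+1}`
    have hI5 : R ^ (-5 : ℝ) * (∫ y, σ (R⁻¹ • y) * ‖V y‖ ^ 2) ≤ B₀ * S ^ (1 / 2 : ℝ) * R ^ (e + 1) := by
      refine le_of_forall_pos_lt_add fun ε hε => ?_
      have h42 : (0 : ℝ) < 4 + 2 * ρ := by linarith
      have htend : Tendsto (fun R' : ℝ => 3 * (c' : ℝ) * R' ^ (-(4 + 2 * ρ))) atTop (𝓝 (3 * (c' : ℝ) * 0)) :=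
        tendsto_const_nhds.mul (tendsto_rpow_neg_atTop h42)
      rw [mul_zero] at htend
      obtain ⟨R', hR'ε, hR'R⟩ := ((htend.eventually (gt_mem_nhds hε)).and (eventually_ge_atTop R)).exists
      have hR'0 : 0 < R' := lt_of_lt_of_le hR0 hR'R
      have htail : R' ^ (-5 : ℝ) * (∫ y, σ (R'⁻¹ • y) * ‖V y‖ ^ 2) ≤ 3 * (c' : ℝ) * R' ^ (-(4 + 2 * ρ)) := by
        have hI := EnergySaturation.cutoffEnergy_le_three_loc hρ h0 h1 hzero hVm hA (hR1.trans hR'R)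
        calc R' ^ (-5 : ℝ) * (∫ y, σ (R'⁻¹ • y) * ‖V y‖ ^ 2) ≤ R' ^ (-5 : ℝ) * (R' ^ (1 - 2 * ρ) * (3 * c')) :=
              mul_le_mul_of_nonneg_left hI (Real.rpow_nonneg hR'0.le _)
          _ = 3 * (c' : ℝ) * (R' ^ (-5 : ℝ) * R' ^ (1 - 2 * ρ)) := by ring
          _ = 3 * (c' : ℝ) * R' ^ (-(4 + 2 * ρ)) := by
              rw [← Real.rpow_add hR'0]; congr 2; ring
      have hid := hId R' hR'R
      have hib := hIb R' hR'R
      have hib' := (abs_le.1 hib).1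
      calc R ^ (-5 : ℝ) * (∫ y, σ (R⁻¹ • y) * ‖V y‖ ^ 2)
          = R' ^ (-5 : ℝ) * (∫ y, σ (R'⁻¹ • y) * ‖V y‖ ^ 2) -
              ∫ r in R..R', (-c)⁻¹ * r ^ ((-5 : ℝ) - 1) *
                ∫ x, (‖V x‖ ^ 2 + 2 * P x) * ⟪V x, gradient (fun z => σ (r⁻¹ • z)) x⟫ := by linarith
        _ ≤ 3 * (c' : ℝ) * R' ^ (-(4 + 2 * ρ)) + B₀ * S ^ (1 / 2 : ℝ) * R ^ (e + 1) := by linarith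
        _ < B₀ * S ^ (1 / 2 : ℝ) * R ^ (e + 1) + ε := by linarith
    -- `N(R) = R^{2ρ+4} · R^{-5} I(R) ≤ B₀ S^{1/2} R^{-a} ≤ B₀ S^{1/2} L^{-a}`
    have hsplit : R ^ (2 * ρ - 1) = R ^ (2 * ρ + 4) * R ^ (-5 : ℝ) := by
      rw [← Real.rpow_add hR0]; congr 1; ring
    have hea : R ^ (2 * ρ + 4) * R ^ (e + 1) = R ^ (-a) := by
      rw [← Real.rpow_add hR0, hedef]; congr 1; ring
    have hRa : R ^ (-a) ≤ L ^ (-a) := Real.rpow_le_rpow_of_nonpos hL0 hR (by linarith)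
    simp only [hN]
    calc R ^ (2 * ρ - 1) * ∫ y, σ (R⁻¹ • y) * ‖V y‖ ^ 2
        = R ^ (2 * ρ + 4) * (R ^ (-5 : ℝ) * ∫ y, σ (R⁻¹ • y) * ‖V y‖ ^ 2) := by rw [hsplit, mul_assoc]
      _ ≤ R ^ (2 * ρ + 4) * (B₀ * S ^ (1 / 2 : ℝ) * R ^ (e + 1)) :=
          mul_le_mul_of_nonneg_left hI5 (Real.rpow_nonneg hR0.le _)
      _ = B₀ * S ^ (1 / 2 : ℝ) * (R ^ (2 * ρ + 4) * R ^ (e + 1)) := by ring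
      _ = B₀ * S ^ (1 / 2 : ℝ) * R ^ (-a) := by rw [hea]
      _ ≤ B₀ * S ^ (1 / 2 : ℝ) * L ^ (-a) := mul_le_mul_of_nonneg_left hRa (by positivity)
  -- ### ABSORPTION: the tail supremum on `[L, ∞)` is at most `B₀² L^{-2a}`
  -- (verbatim from `EnergySaturation.ae_eq_zero_of_subExtremal_loc`)
  have hdecay : ∀ L : ℝ, 1 ≤ L → N L ≤ B₀ ^ 2 * (L ^ (-a)) ^ 2 := by
    intro L hL
    have hL0 : 0 < L := lt_of_lt_of_le one_pos hL
    set T : Set ℝ := N '' Ici L with hT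
    have hTne : T.Nonempty := ⟨N L, L, Set.self_mem_Ici, rfl⟩
    have hTbdd : BddAbove T := ⟨3 * c', by
      rintro _ ⟨R, hR, rfl⟩; exact hN3 R (hL.trans (Set.mem_Ici.1 hR))⟩
    set S : ℝ := sSup T with hSdef
    have hSsup : ∀ R, L ≤ R → N R ≤ S := fun R hR => le_csSup hTbdd ⟨R, Set.mem_Ici.2 hR, rfl⟩
    have hS0 : 0 ≤ S := (hN0 L hL0).trans (hSsup L le_rfl)
    have hS3 : S ≤ 3 * c' := csSup_le hTne (by
      rintro _ ⟨R, hR, rfl⟩; exact hN3 R (hL.trans (Set.mem_Ici.1 hR)))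
    have hSle : S ≤ B₀ * S ^ (1 / 2 : ℝ) * L ^ (-a) :=
      csSup_le hTne (by rintro _ ⟨R, hR, rfl⟩; exact hkey L hL S hS0 hS3 hSsup R (Set.mem_Ici.1 hR))
    have habs := EnergySaturation.le_sq_of_le_mul_sqrt hS0 hB₀0 (Real.rpow_nonneg hL0.le _) hSle
    exact (hSsup L le_rfl).trans habs
  -- ### CONCLUSION: the energy of every ball vanishes (verbatim from `EnergySaturation.ae_eq_zero_of_subExtremal_loc`)
  have hballzero : ∀ L₀ : ℝ, 0 < L₀ → ∫⁻ y in ball (0 : EuclideanSpace ℝ (Fin 3)) L₀, ‖V y‖ₑ ^ 2 = 0 := by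
    intro L₀ hL₀
    refine le_antisymm (ENNReal.le_of_forall_pos_le_add fun δ hδ _ => ?_) zero_le
    rw [zero_add]
    have hexp : (1 - 2 * ρ) + -(2 * a) < 0 := by rw [hadef]; linarith
    have htend : Tendsto (fun L : ℝ => B₀ ^ 2 * L ^ ((1 - 2 * ρ) + -(2 * a))) atTop (𝓝 (B₀ ^ 2 * 0)) := by
      refine tendsto_const_nhds.mul ?_
      have := tendsto_rpow_neg_atTop (y := -((1 - 2 * ρ) + -(2 * a))) (by linarith)
      simpa using this
    rw [mul_zero] at htend
    have hev := (htend.eventually (gt_mem_nhds (show (0 : ℝ) < δ from hδ))).and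
      (eventually_ge_atTop (max L₀ 1))
    obtain ⟨L, hLδ, hLge⟩ := hev.exists
    have hL1 : 1 ≤ L := (le_max_right _ _).trans hLge
    have hL0 : 0 < L := lt_of_lt_of_le one_pos hL1
    have hLL₀ : L₀ ≤ L := (le_max_left _ _).trans hLge
    have h1 := EnergySaturation.lintegral_ball_sq_le_cutoffEnergy hσs.continuous hσc h0 hone hV2 hL0
    have hNL := hdecay L hL1
    have hI : ∫ y, σ (L⁻¹ • y) * ‖V y‖ ^ 2 ≤ B₀ ^ 2 * L ^ ((1 - 2 * ρ) + -(2 * a)) := by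
      have hRR : L ^ (1 - 2 * ρ) * L ^ (2 * ρ - 1) = 1 := by rw [← Real.rpow_add hL0]; norm_num
      have e2 : (L ^ (-a)) ^ 2 = L ^ (-(2 * a)) := by
        rw [← Real.rpow_natCast, ← Real.rpow_mul hL0.le]; norm_num; ring_nf
      calc ∫ y, σ (L⁻¹ • y) * ‖V y‖ ^ 2 = L ^ (1 - 2 * ρ) * N L := by
            simp only [hN]; rw [← mul_assoc, hRR, one_mul]
        _ ≤ L ^ (1 - 2 * ρ) * (B₀ ^ 2 * (L ^ (-a)) ^ 2) :=
            mul_le_mul_of_nonneg_left hNL (Real.rpow_nonneg hL0.le _)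
        _ = B₀ ^ 2 * (L ^ (1 - 2 * ρ) * L ^ (-(2 * a))) := by rw [e2]; ring
        _ = B₀ ^ 2 * L ^ ((1 - 2 * ρ) + -(2 * a)) := by rw [← Real.rpow_add hL0]
    calc ∫⁻ y in ball (0 : EuclideanSpace ℝ (Fin 3)) L₀, ‖V y‖ₑ ^ 2
        ≤ ∫⁻ y in ball (0 : EuclideanSpace ℝ (Fin 3)) L, ‖V y‖ₑ ^ 2 := lintegral_mono_set (ball_subset_ball hLL₀)
      _ ≤ ENNReal.ofReal (∫ y, σ (L⁻¹ • y) * ‖V y‖ ^ 2) := h1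
      _ ≤ ENNReal.ofReal (B₀ ^ 2 * L ^ ((1 - 2 * ρ) + -(2 * a))) := ENNReal.ofReal_le_ofReal hI
      _ ≤ (δ : ℝ≥0∞) := by
          rw [← ENNReal.ofReal_coe_nnreal]; exact ENNReal.ofReal_le_ofReal hLδ.le
  -- ### hence `V = 0` (a.e., then everywhere by continuity) and `u = 0`
  have hball_ae : ∀ n : ℕ, ∀ᵐ y ∂(volume.restrict (ball (0 : EuclideanSpace ℝ (Fin 3)) ((n : ℝ) + 1))), V y = 0 := by
    intro n
    have h := hballzero ((n : ℝ) + 1) (by positivity)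
    rw [lintegral_eq_zero_iff' (hVm.restrict.enorm.pow_const 2)] at h
    filter_upwards [h] with y hy
    simpa using hy
  have hunion : (⋃ n : ℕ, ball (0 : EuclideanSpace ℝ (Fin 3)) ((n : ℝ) + 1)) = univ := by
    refine eq_univ_of_forall fun y => mem_iUnion.2 ?_
    obtain ⟨n, hn⟩ := exists_nat_gt ‖y‖
    exact ⟨n, by rw [mem_ball, dist_zero_right]; linarith⟩
  have hVae := (ae_restrict_iUnion_iff (μ := (volume : Measure (EuclideanSpace ℝ (Fin 3))))
    (fun n : ℕ => ball (0 : EuclideanSpace ℝ (Fin 3)) ((n : ℝ) + 1)) (fun y => V y = 0)).2 hball_ae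
  rw [hunion, Measure.restrict_univ] at hVae
  have hV0 : V = 0 := (Continuous.ae_eq_iff_eq volume hVc continuous_const).1 hVae
  filter_upwards [ae_restrict_mem (measurableSet_Iio.prod MeasurableSet.univ)] with q hq
  rw [mem_prod, mem_Iio] at hq
  simp only [uncurry, Pi.zero_apply]
  rw [show u q.1 q.2 = uncurry u q from rfl]
  show u q.1 q.2 = 0
  rw [hbr q.1 hq.1 q.2, hV0, Pi.zero_apply, smul_zero]

end BreatherRigidity

end Summit.NavierStokesRegularity.NavierStokesRegularity.Theorems.PowerGaugeEulerLiouville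

end
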